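import Summits.CriticalPhenomena.PercolationContinuityZ3.Theorems.SahiCISMonotoneImageCI

/-!
# CI in the a.e.-kernel sense is not closed under weak convergence (dimension `3`)

Cell `prim-sahi`, literature seat (generation 31; Theorems/ being prover-only, to be landed by a prover seat);
`--supports stmt-CriticalPhenomena-4575`.  No named facts, no sorries.  Sequel of `SahiCISMonotoneImageCI.lean`.

`SahiCISNonClosure.lean` (typer gen 17) shows that CIS in the kernel sense is not weakly closed on `[0,1]³`
(Colangelo–Müller–Scarsini's Theorem 5 concerns their weaker Definition 4).  The same holds for CI
(CIS after every permutation of the coordinates, `IsCIae`): move the top value of the FIRST coordinate of the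
six-atom CI law down to `½`.  Concretely, with the four-letter code chain `chainAt t = (0, ½, t, 1)`,
`½ < t < 1`, and codes `sixCodes₄` (first coordinate in the letters `{0,1,2}`, the other two in `{0,1,3}`):

* `sixAtomLawAt t = (4δ_(0,0,0) + δ_(½,0,0) + 2δ_(½,½,0) + δ_(t,0,1) + δ_(t,½,1) + δ_(t,1,1)) / 10` is CI for
  `½ < t < 1` (`isCIae_sixAtomLawAt`; the kernel check `cisCheckAll_sixCodes₄_comp` covers all `27` coordinate
  maps), and `sixAtomLawAt ½ = sixImageLaw` (`sixAtomLawAt_half`), which is not even CIS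
  (`not_isCISae_sixImageLaw`);
* `tendsto_integral_smul_codedLaw` — coded laws depend continuously (weakly) on the code chain; hence
  `tendsto_sixAtomPMAt`: `sixAtomLawAt (½ + ¼/(j+1)) → sixImageLaw` weakly;
* **`exists_isCIae_tendsto_not_isCISae`** / **`exists_isCIae_tendsto_not_isCIae`**: a weakly convergent
  sequence of CI laws on `[0,1]³` whose limit is not CIS.

So, like CIS, classical CI (Müller–Stoyan Def. 3.10.9 c) in the kernel sense fails property B6 (weak closure) of
Colangelo–Scarsini–Shaked / Colangelo–Müller–Scarsini in dimension `3`, while their Definition-4-CI has it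
(Thm. 6 of the source).  References: Colangelo–Müller–Scarsini 2006, §2 (B6), Thms. 5–6
[ColangeloMullerScarsini2006]; Müller–Stoyan 2002, Def. 3.10.9 [MullerStoyan2002].  The example is this work.
-/

noncomputable section

namespace Summit.CriticalPhenomena.PercolationContinuityZ3.Theorems.SahiCIS

open MeasureTheory Set Function Filter Topology
open Summit.CriticalPhenomena.PercolationContinuityZ3.Theorems.SahiBoxTP2
open scoped ENNReal unitInterval BoundedContinuousFunction

/-! ### Integrals against atomic laws; weak continuity in the code chain -/

section Integral

variable {α : Type*} [MeasurableSpace α] [TopologicalSpace α] [OpensMeasurableSpace α]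
  [MeasurableSingletonClass α] {n : ℕ}

/-- The integral of a bounded continuous function against an atomic law is the weighted sum of its values at
the atoms. [this work] -/
theorem integral_atomicLaw (p : Fin n → α) (w : Fin n → ℕ) (g : α →ᵇ ℝ) :
    ∫ x, g x ∂(atomicLaw p w) = ∑ k, (w k : ℝ) * g (p k) := by
  rw [atomicLaw, integral_finsetSum_measure fun k _ =>
    (g.integrable _).smul_measure (ENNReal.natCast_ne_top (w k))]
  refine Finset.sum_congr rfl fun k _ => ?_
  rw [integral_smul_measure, integral_dirac, ENNReal.toReal_natCast, smul_eq_mul]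

/-- The same for a scaled atomic law. [this work] -/
theorem integral_smul_atomicLaw (r : ℝ≥0∞) (p : Fin n → α) (w : Fin n → ℕ) (g : α →ᵇ ℝ) :
    ∫ x, g x ∂(r • atomicLaw p w) = r.toReal * ∑ k, (w k : ℝ) * g (p k) := by
  rw [integral_smul_measure, integral_atomicLaw, smul_eq_mul]

end Integral

section WeakLimit

variable {n m d : ℕ}

/-- **Coded laws depend continuously on the code chain** (weak topology): if the code values converge, the
integrals of bounded continuous functions against the scaled coded laws converge. [this work] -/
theorem tendsto_integral_smul_codedLaw (r : ℝ≥0∞) (c : Fin n → Fin d → Fin m) (w : Fin n → ℕ)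
    {e : ℕ → Fin m → I} {e' : Fin m → I} (he : ∀ v, Tendsto (fun j => e j v) atTop (𝓝 (e' v)))
    (g : (Fin d → I) →ᵇ ℝ) :
    Tendsto (fun j => ∫ x, g x ∂(r • codedLaw (e j) c w)) atTop
      (𝓝 (∫ x, g x ∂(r • codedLaw e' c w))) := by
  simp only [codedLaw, integral_smul_atomicLaw]
  refine Tendsto.const_mul _ (tendsto_finsetSum _ fun k _ => Tendsto.const_mul _ ?_)
  have hk : Tendsto (fun j => (e j ∘ c k : Fin d → I)) atTop (𝓝 (e' ∘ c k)) :=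
    tendsto_pi_nhds.2 fun i => he (c k i)
  exact (g.continuous.tendsto _).comp hk

end WeakLimit

/-! ### The moving six-atom family -/

section Family

/-- The code chain `(0, ½, t, 1)`. [this work] -/
def chainAt (t : I) : Fin 4 → I := ![⊥, ptHalf, t, ⊤]

/-- For `½ < t < 1` the chain is strictly increasing. [this work] -/
theorem strictMono_chainAt {t : I} (h1 : ptHalf < t) (h2 : t < ⊤) : StrictMono (chainAt t) := by
  refine Fin.strictMono_iff_lt_succ.2 fun i => ?_
  fin_cases i
  · change (0 : ℝ) < 2⁻¹; norm_num
  · exact h1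
  · exact h2

/-- The six atoms in the four-letter alphabet: first coordinate in `{0,1,2}`, the others in `{0,1,3}`.
[this work] -/
def sixCodes₄ : Fin 6 → Fin 3 → Fin 4 :=
  ![![0, 0, 0], ![1, 0, 0], ![1, 1, 0], ![2, 0, 3], ![2, 1, 3], ![2, 3, 3]]

/-- Normalised coded laws with the six weights are probability measures (any chain, any codes). [this work] -/
instance isProbabilityMeasure_smul_codedLaw_six' {m d : ℕ} (e : Fin m → I) (c : Fin 6 → Fin d → Fin m) :
    IsProbabilityMeasure ((10 : ℝ≥0∞)⁻¹ • codedLaw e c sixWeights) :=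
  ⟨by
    rw [Measure.smul_apply, smul_eq_mul, codedLaw_univ, sum_sixWeights]
    exact ENNReal.inv_mul_cancel (by norm_num) (by norm_num)⟩

/-- **The moving family** `(4δ_(0,0,0) + δ_(½,0,0) + 2δ_(½,½,0) + δ_(t,0,1) + δ_(t,½,1) + δ_(t,1,1)) / 10`.
[this work] -/
def sixAtomLawAt (t : I) : Measure (Fin 3 → I) :=
  (10 : ℝ≥0∞)⁻¹ • codedLaw (chainAt t) sixCodes₄ sixWeights

/-- Members of the family are probability measures. [this work] -/
instance isProbabilityMeasure_sixAtomLawAt (t : I) : IsProbabilityMeasure (sixAtomLawAt t) :=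
  isProbabilityMeasure_smul_codedLaw_six' _ _

/-- **Kernel computation**: the atom condition holds at every level for the four-letter codes relabelled by any
coordinate map (27 maps × 3 levels). [this work] -/
theorem cisCheckAll_sixCodes₄_comp :
    ∀ τ : Fin 3 → Fin 3, cisCheckAll 3 (fun k => sixCodes₄ k ∘ τ) sixWeights = true := by
  decide +kernel

/-- **For `½ < t < 1` the member `sixAtomLawAt t` is CI.** [this work] -/
theorem isCIae_sixAtomLawAt {t : I} (h1 : ptHalf < t) (h2 : t < ⊤) : IsCIae 3 (sixAtomLawAt t) := by
  intro τ
  rw [sixAtomLawAt, Measure.map_smul, codedLaw_map_comp]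
  exact (isCISae_smul_codedLaw_iff (strictMono_chainAt h1 h2) _ _ (by norm_num) (by norm_num)).2
    (cisCheckAll_sixCodes₄_comp ⇑τ)

/-- **At `t = ½` the family degenerates to the (non-CIS) image law.** [this work] -/
theorem sixAtomLawAt_half : sixAtomLawAt ptHalf = sixImageLaw := by
  rw [sixAtomLawAt, sixImageLaw, codedLaw, codedLaw]
  congr 2
  funext k
  fin_cases k <;> (funext i; fin_cases i <;> rfl)

/-- The thresholds `t_j = ½ + ¼ /(j+1) ∈ (½, ¾]`. [this work] -/
def tHalfSeq (j : ℕ) : I := ⟨2⁻¹ + 4⁻¹ * (1 / ((j : ℝ) + 1)), by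
  rw [Set.mem_Icc]
  have h0 : (0 : ℝ) ≤ 1 / ((j : ℝ) + 1) := by positivity
  have h1 : 1 / ((j : ℝ) + 1) ≤ 1 := by
    rw [div_le_one (by positivity)]
    linarith [j.cast_nonneg (α := ℝ)]
  constructor <;> nlinarith⟩

/-- `½ < t_j`. [this work] -/
theorem ptHalf_lt_tHalfSeq (j : ℕ) : ptHalf < tHalfSeq j := by
  change (2⁻¹ : ℝ) < 2⁻¹ + 4⁻¹ * (1 / ((j : ℝ) + 1))
  have : (0 : ℝ) < 1 / ((j : ℝ) + 1) := by positivity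
  linarith

/-- `t_j < 1`. [this work] -/
theorem tHalfSeq_lt_top (j : ℕ) : tHalfSeq j < ⊤ := by
  change (2⁻¹ + 4⁻¹ * (1 / ((j : ℝ) + 1)) : ℝ) < 1
  have h1 : 1 / ((j : ℝ) + 1) ≤ 1 := by
    rw [div_le_one (by positivity)]
    linarith [j.cast_nonneg (α := ℝ)]
  linarith

/-- `t_j → ½`. [this work] -/
theorem tendsto_tHalfSeq : Tendsto tHalfSeq atTop (𝓝 ptHalf) := by
  rw [tendsto_subtype_rng]
  change Tendsto (fun j : ℕ => (2⁻¹ : ℝ) + 4⁻¹ * (1 / ((j : ℝ) + 1))) atTop (𝓝 (2⁻¹ : ℝ))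
  simpa using ((tendsto_one_div_add_atTop_nhds_zero_nat).const_mul (4⁻¹ : ℝ)).const_add (2⁻¹ : ℝ)

/-- The code chains along the sequence converge to the degenerate chain `(0, ½, ½, 1)`. [this work] -/
theorem tendsto_chainAt_tHalfSeq (v : Fin 4) :
    Tendsto (fun j => chainAt (tHalfSeq j) v) atTop (𝓝 (chainAt ptHalf v)) := by
  fin_cases v
  · exact tendsto_const_nhds
  · exact tendsto_const_nhds
  · exact tendsto_tHalfSeq
  · exact tendsto_const_nhds

/-- The family as probability measures. [this work] -/
def sixAtomPMAt (t : I) : ProbabilityMeasure (Fin 3 → I) := ⟨sixAtomLawAt t, inferInstance⟩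

/-- The image law as a probability measure. [this work] -/
def sixImagePM : ProbabilityMeasure (Fin 3 → I) := ⟨sixImageLaw, inferInstance⟩

/-- Coercion of `sixAtomPMAt`. [this work] -/
@[simp] theorem coe_sixAtomPMAt (t : I) :
    ((sixAtomPMAt t : ProbabilityMeasure (Fin 3 → I)) : Measure (Fin 3 → I)) = sixAtomLawAt t := rfl

/-- Coercion of `sixImagePM`. [this work] -/
@[simp] theorem coe_sixImagePM :
    ((sixImagePM : ProbabilityMeasure (Fin 3 → I)) : Measure (Fin 3 → I)) = sixImageLaw :=
  rfl

/-- **Weak convergence of the family to the image law** along `t_j → ½`. [this work] -/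
theorem tendsto_sixAtomPMAt : Tendsto (fun j => sixAtomPMAt (tHalfSeq j)) atTop (𝓝 sixImagePM) := by
  rw [ProbabilityMeasure.tendsto_iff_forall_integral_tendsto]
  intro g
  simp only [coe_sixAtomPMAt, coe_sixImagePM, ← sixAtomLawAt_half, sixAtomLawAt]
  exact tendsto_integral_smul_codedLaw _ sixCodes₄ sixWeights tendsto_chainAt_tHalfSeq g

end Family

/-! ### The theorem -/

section Main

/-- **CI in the a.e.-kernel sense is not closed under weak convergence on `[0,1]³`**: the CI laws
`sixAtomLawAt (½ + ¼/(j+1))` converge weakly to `sixImageLaw`, which is not even CIS. [this work] -/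
theorem exists_isCIae_tendsto_not_isCISae :
    ∃ (μs : ℕ → ProbabilityMeasure (Fin 3 → I)) (μ : ProbabilityMeasure (Fin 3 → I)),
      (∀ j, IsCIae 3 (μs j : Measure (Fin 3 → I))) ∧ Tendsto μs atTop (𝓝 μ) ∧
        ¬ IsCISae 3 (μ : Measure (Fin 3 → I)) :=
  ⟨fun j => sixAtomPMAt (tHalfSeq j), sixImagePM,
    fun j => isCIae_sixAtomLawAt (ptHalf_lt_tHalfSeq j) (tHalfSeq_lt_top j), tendsto_sixAtomPMAt,
    not_isCISae_sixImageLaw⟩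

/-- **CI in the a.e.-kernel sense is not closed under weak convergence on `[0,1]³`**, CI-to-CI form. [this work] -/
theorem exists_isCIae_tendsto_not_isCIae :
    ∃ (μs : ℕ → ProbabilityMeasure (Fin 3 → I)) (μ : ProbabilityMeasure (Fin 3 → I)),
      (∀ j, IsCIae 3 (μs j : Measure (Fin 3 → I))) ∧ Tendsto μs atTop (𝓝 μ) ∧
        ¬ IsCIae 3 (μ : Measure (Fin 3 → I)) :=
  ⟨fun j => sixAtomPMAt (tHalfSeq j), sixImagePM,
    fun j => isCIae_sixAtomLawAt (ptHalf_lt_tHalfSeq j) (tHalfSeq_lt_top j), tendsto_sixAtomPMAt,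
    not_isCIae_sixImageLaw⟩

end Main

end Summit.CriticalPhenomena.PercolationContinuityZ3.Theorems.SahiCIS

end
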